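import Literature.AnabelianGeometry.SemiGraphs.MetabelianLeafStarMaximalCompact
import Literature.AnabelianGeometry.SemiGraphs.MetabelianLeafStarAnchored
import Literature.AnabelianGeometry.SemiGraphs.TemperedCompactVerticialOrCommutative
import Literature.AnabelianGeometry.SemiGraphs.TemperedVerticialNamedFactsProofs
import HarnessLib

/-!
# At the rayless star, VERTICIAL = MAXIMAL COMPACT ∧ NON-COMMUTATIVE — so every isomorphism of chart groups
# permutes the verticial subgroups ([SemiAnbd] Thm 3.7 (iv), Cor 3.9 proof, pp. 41–43)

Mochizuki, *Semi-graphs of anabelioids*, Publ. RIMS **42** (2006), §3, Theorem 3.7 (iv) p. 41 ("the maximal compact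
subgroups of `π₁^temp(𝒢)` are precisely the verticial subgroups") and the proof of Corollary 3.9 p. 43 (a
quasi-geometric isomorphism "preserves verticial subgroups [cf. Theorem 3.7, (iv)]") [cite: MochizukiSemiAnbd2006, Thm 3.7(iv) p.41].

PROOF-ONLY file (abc-iut cell, layer L3, row «T37iv-ANCHOR-FREE@RAYLESS-STAR» sequel «VERT⟺NONCOMM-MAXCPT@STAR»,
seat abc-iut-L3-t8 gen 7; no definition, no named fact).  At `𝒢⋆(p)` the sentence «maximal compact ⇒ verticial» of
Thm 3.7 (iv) FAILS (abc-iut-L3-t8 gen 7, `metabelianLeafStar_not_maximalCompactIffVerticialAt`: the escaping procyclic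
`⟨c⟩‾ ≅ ℤ_p` is an exotic maximal compact subgroup), so the first step of the printed proof of Cor. 3.9 — "a
quasi-geometric isomorphism preserves verticial subgroups, by Thm 3.7 (iv)" — cannot be run as printed there.  It is
rescued by COMMUTATIVITY: every exotic maximal compact subgroup is commutative (abc-iut-w6-d064,
`TemperedCompactVerticialOrCommutative`), every verticial subgroup is maximal compact (abc-iut-w6-d064 / abc-iut-L3-t6,
`metabelianLeafStar_isMaximalCompactSubgroup_of_mem_verticialSubgroups`) and NON-commutative (the vertex groups
`F̂₂⁽ᵖ⁾`, `ℤ_p ⋊ ℤ_p` are slim and nontrivial; Thm 3.7 (i) `verticialInjective_holds`).  Hence: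

* `metabelianLeafStar_exists_not_commute_of_mem_verticialSubgroups` — verticial subgroups are non-commutative;
* `metabelianLeafStar_mem_verticialSubgroups_iff` — **`H` is verticial (for some vertex) iff `H` is a maximal compact
  subgroup containing two non-commuting elements** — a characterisation in the language of the TOPOLOGICAL GROUP alone;
* `metabelianLeafStar_map_mem_verticialSubgroups_of_continuousMulEquiv` — **every isomorphism of topological groups
  between chart groups of `π₁^temp(𝒢⋆(p))` (in particular every bicontinuous AUTOMORPHISM of one chart group) carries
  verticial subgroups to verticial subgroups** — the first step of Cor. 3.9 (b) at the star for isomorphisms, where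
  (iv) itself fails; `…_symm_iff` the two-sided form.

Consumer: the banked row «COR39-UPTOTWIST@RAYLESS-STAR» (abc-iut-L3-d1 lineage).  Honest framing: OUR typed tempered
fundamental group of OUR countable carrier; print's Thm 3.7 (iv) / Cor. 3.9 at finite `𝔾` untouched; nothing here
bears on [IUTchIII] Cor. 3.12; no side taken; typed ≠ proved.
-/

noncomputable section

open CategoryTheory Topology

namespace Literature.AnabelianGeometry.SemiGraphs

open Literature.AlgebraicGeometry.Frobenioids (IsSlimGroup)

/-! ### Generic: slim nontrivial groups are non-commutative; transport of maximal compactness -/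

/-- A SLIM topological group with a nontrivial element has two non-commuting elements (the centraliser of the open
subgroup `⊤` is trivial). [cite: MochizukiSemiAnbd2006, Def 2.4(ii) p.25] -/
theorem exists_not_commute_of_isSlimGroup {G : Type*} [Group G] [TopologicalSpace G] (hG : IsSlimGroup G)
    {x : G} (hx : x ≠ 1) : ∃ y : G, x * y ≠ y * x := by
  by_contra h
  push Not at h
  have hmem : x ∈ Subgroup.centralizer ((⊤ : Subgroup G) : Set G) :=
    Subgroup.mem_centralizer_iff.mpr fun y _ => (h y).symm
  rw [hG.centralizer_eq_bot ⊤ (by rw [Subgroup.coe_top]; exact isOpen_univ)] at hmem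
  exact hx hmem

section Transport

variable {A B : Type} [Group A] [TopologicalSpace A] [Group B] [TopologicalSpace B]

/-- An isomorphism of topological groups carries maximal compact subgroups to maximal compact subgroups (local copy
of the folklore transport). [cite: MochizukiSemiAnbd2006, Thm 3.7(iv) p.41] -/
private theorem isMaximalCompactSubgroup_map_continuousMulEquiv' (e : A ≃ₜ* B) {K : Subgroup A}
    (hK : IsMaximalCompactSubgroup K) : IsMaximalCompactSubgroup (K.map e.toMonoidHom) := by
  refine ⟨?_, fun K' hK' hle => ?_⟩
  · rw [Subgroup.coe_map]
    exact hK.1.image e.continuous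
  · have hK'c : IsCompact ((K'.map e.symm.toMonoidHom : Subgroup A) : Set A) := by
      rw [Subgroup.coe_map]
      exact hK'.image e.symm.continuous
    have hle' : K ≤ K'.map e.symm.toMonoidHom := fun x hx =>
      ⟨e x, hle ⟨x, hx, rfl⟩, e.symm_apply_apply x⟩
    have heq := hK.2 _ hK'c hle'
    refine le_antisymm (fun y hy => ?_) hle
    have hy' : e.symm y ∈ K := by
      rw [← heq]
      exact ⟨y, hy, rfl⟩
    exact ⟨e.symm y, hy', e.apply_symm_apply y⟩

end Transport

namespace ProfiniteSemiGraph

variable (p : ℕ) [hp : Fact p.Prime]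

/-! ### Vertex groups of `𝒢⋆(p)` are non-commutative -/

/-- The unit translation of the leaf `m` is not the identity (its translation character is `1 (mod p)`).
[cite: MochizukiSemiAnbd2006, Def 2.1 p.22] -/
theorem Iw_translLeaf_ne_one (m : ℕ) : Iw.translLeaf (p := p) m ≠ 1 := by
  intro h
  have hem : 1 ≤ m + 1 := by omega
  have h1 : Iw.aChar 1 m hem (Iw.translLeaf (p := p) m) = Multiplicative.ofAdd 1 := Iw.aChar_translLeaf hem
  have h2 : Iw.aChar 1 m hem (1 : Iw.Leaf (p := p) m) = 1 := map_one _
  rw [h, h2] at h1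
  have h01 := congrArg Multiplicative.toAdd h1
  rw [toAdd_one, toAdd_ofAdd] at h01
  haveI : Fact (1 < p ^ 1) := ⟨by rw [pow_one]; exact hp.out.one_lt⟩
  exact zero_ne_one h01

/-- Every vertex group of `𝒢⋆(p)` has a nontrivial element (`a ∈ F̂₂⁽ᵖ⁾`, the unit translation of a leaf).
[cite: MochizukiSemiAnbd2006, Def 2.1 p.22] -/
theorem metabelianLeafStar_exists_ne_one (v : (metabelianLeafStar p).graph.Vertex) :
    ∃ x : (metabelianLeafStar p).Gv v, x ≠ 1 := by
  cases v with
  | none => exact ⟨FreeProPRankTwo.a p, FreeProPRankTwo.a_ne_one p⟩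
  | some m => exact ⟨Iw.translLeaf (p := p) m, Iw_translLeaf_ne_one p m⟩

/-- Every vertex group of `𝒢⋆(p)` is slim (abc-iut-L3-t8 gen 6, bricks S2/S3). [cite: MochizukiSemiAnbd2006, Def 2.4(ii) p.25] -/
theorem metabelianLeafStar_isSlimGroup_Gv (v : (metabelianLeafStar p).graph.Vertex) :
    IsSlimGroup ((metabelianLeafStar p).Gv v) := by
  cases v with
  | none => exact FreeProPRankTwo.isSlimGroup p
  | some m => exact Iw.isSlimGroup_leaf m

/-- **Verticial subgroups of `π₁^temp(𝒢⋆(p))` are NON-commutative** (every chart): the vertex group is slim with a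
nontrivial element, and verticial homomorphisms are injective (Thm 3.7 (i), `verticialInjective_holds`).
[cite: MochizukiSemiAnbd2006, Thm 3.7(i) p.40] -/
theorem metabelianLeafStar_exists_not_commute_of_mem_verticialSubgroups (c : TemperedPiChart (metabelianLeafStar p))
    {v : (metabelianLeafStar p).graph.Vertex} {H : Subgroup c.G} (hH : H ∈ verticialSubgroups c v) :
    ∃ g₁ ∈ H, ∃ g₂ ∈ H, g₁ * g₂ ≠ g₂ * g₁ := by
  obtain ⟨ψ, hψ, rfl⟩ := hH
  have hinj : Function.Injective ψ :=
    (verticialInjective_holds (metabelianLeafStar p) (metabelianLeafStar_thm37Hypotheses' p) c v).2 ψ hψ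
  obtain ⟨x, hx⟩ := metabelianLeafStar_exists_ne_one p v
  obtain ⟨y, hxy⟩ := exists_not_commute_of_isSlimGroup (metabelianLeafStar_isSlimGroup_Gv p v) hx
  refine ⟨ψ x, ⟨x, rfl⟩, ψ y, ⟨y, rfl⟩, fun h => hxy (hinj ?_)⟩
  simpa only [map_mul] using h

/-! ### The topological characterisation of the verticial subgroups -/

/-- **At `𝒢⋆(p)`, VERTICIAL ⟺ MAXIMAL COMPACT ∧ NON-COMMUTATIVE** (every chart, hypothesis-free): a subgroup of
`π₁^temp(𝒢⋆(p))` is verticial (for some vertex) iff it is a maximal compact subgroup with two non-commuting elements.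
(⟹: abc-iut-w6-d064/abc-iut-L3-t6's `metabelianLeafStar_isMaximalCompactSubgroup_of_mem_verticialSubgroups` and the
preceding theorem; ⟸: abc-iut-w6-d064's `exists_mem_verticialSubgroups_of_isMaximalCompactSubgroup_of_not_commutative_of_commEdges`,
edge groups `ℤ_p` commutative.)  This is what survives of Thm 3.7 (iv)'s first sentence at the star, where the
exotic maximal compact subgroups are exactly the commutative ones. [cite: MochizukiSemiAnbd2006, Thm 3.7(iv) p.41] -/
theorem metabelianLeafStar_mem_verticialSubgroups_iff (c : TemperedPiChart (metabelianLeafStar p)) (H : Subgroup c.G) :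
    (∃ v : (metabelianLeafStar p).graph.Vertex, H ∈ verticialSubgroups c v) ↔
      IsMaximalCompactSubgroup H ∧ ∃ g₁ ∈ H, ∃ g₂ ∈ H, g₁ * g₂ ≠ g₂ * g₁ := by
  constructor
  · rintro ⟨v, hH⟩
    exact ⟨metabelianLeafStar_isMaximalCompactSubgroup_of_mem_verticialSubgroups p c hH,
      metabelianLeafStar_exists_not_commute_of_mem_verticialSubgroups p c hH⟩
  · rintro ⟨hK, hK'⟩
    exact exists_mem_verticialSubgroups_of_isMaximalCompactSubgroup_of_not_commutative_of_commEdges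
      (metabelianLeafStar_thm37Hypotheses' p).toProp36Hypotheses (metabelianLeafStar_commEdges p) c H hK hK'

/-! ### Isomorphisms of chart groups permute the verticial subgroups -/

/-- **Every isomorphism of topological groups between chart groups of `π₁^temp(𝒢⋆(p))` carries verticial subgroups to
verticial subgroups** (first step of the proof of Cor. 3.9 (b) at the star, for isomorphisms — obtained WITHOUT the
failing sentence of Thm 3.7 (iv): maximal compactness and non-commutativity are invariants of the topological group).
In particular every bicontinuous automorphism of a chart group permutes its verticial subgroups.
[cite: MochizukiSemiAnbd2006, Cor 3.9 p.43] -/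
theorem metabelianLeafStar_map_mem_verticialSubgroups_of_continuousMulEquiv
    (c c' : TemperedPiChart (metabelianLeafStar p)) (e : c.G ≃ₜ* c'.G)
    {v : (metabelianLeafStar p).graph.Vertex} {H : Subgroup c.G} (hH : H ∈ verticialSubgroups c v) :
    ∃ v' : (metabelianLeafStar p).graph.Vertex, H.map e.toMonoidHom ∈ verticialSubgroups c' v' := by
  obtain ⟨hK, g₁, hg₁, g₂, hg₂, hne⟩ := (metabelianLeafStar_mem_verticialSubgroups_iff p c H).mp ⟨v, hH⟩
  refine (metabelianLeafStar_mem_verticialSubgroups_iff p c' _).mpr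
    ⟨isMaximalCompactSubgroup_map_continuousMulEquiv' e hK, e g₁, ⟨g₁, hg₁, rfl⟩, e g₂, ⟨g₂, hg₂, rfl⟩, fun h => hne ?_⟩
  apply e.injective
  simpa only [map_mul] using h

/-- **Two-sided form**: `H ≤ c.G` is verticial iff `e(H) ≤ c'.G` is, for every isomorphism of topological groups
`e : c.G ⥲ c'.G` of chart groups of `π₁^temp(𝒢⋆(p))`. [cite: MochizukiSemiAnbd2006, Cor 3.9 p.43] -/
theorem metabelianLeafStar_exists_mem_verticialSubgroups_map_iff
    (c c' : TemperedPiChart (metabelianLeafStar p)) (e : c.G ≃ₜ* c'.G) (H : Subgroup c.G) :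
    (∃ v' : (metabelianLeafStar p).graph.Vertex, H.map e.toMonoidHom ∈ verticialSubgroups c' v') ↔
      ∃ v : (metabelianLeafStar p).graph.Vertex, H ∈ verticialSubgroups c v := by
  refine ⟨fun ⟨v', h'⟩ => ?_, fun ⟨v, h⟩ => metabelianLeafStar_map_mem_verticialSubgroups_of_continuousMulEquiv p c c' e h⟩
  obtain ⟨v, hv⟩ := metabelianLeafStar_map_mem_verticialSubgroups_of_continuousMulEquiv p c' c e.symm h'
  refine ⟨v, ?_⟩
  have hback : (H.map e.toMonoidHom).map e.symm.toMonoidHom = H := by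
    rw [Subgroup.map_map]
    conv_rhs => rw [← Subgroup.map_id H]
    congr 1
    ext x
    exact e.symm_apply_apply x
  rwa [hback] at hv

/-- **Automorphism form**: every bicontinuous automorphism `α` of a chart group of `π₁^temp(𝒢⋆(p))` permutes the set
of verticial subgroups: `α(H)` is verticial iff `H` is. [cite: MochizukiSemiAnbd2006, Cor 3.9 p.43] -/
theorem metabelianLeafStar_exists_mem_verticialSubgroups_map_aut_iff (c : TemperedPiChart (metabelianLeafStar p))
    (α : c.G ≃ₜ* c.G) (H : Subgroup c.G) :
    (∃ v : (metabelianLeafStar p).graph.Vertex, H.map α.toMonoidHom ∈ verticialSubgroups c v) ↔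
      ∃ v : (metabelianLeafStar p).graph.Vertex, H ∈ verticialSubgroups c v :=
  metabelianLeafStar_exists_mem_verticialSubgroups_map_iff p c c α H

end ProfiniteSemiGraph

end Literature.AnabelianGeometry.SemiGraphs

end
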